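import Mathlib.NumberTheory.NumberField.Completion.InfinitePlace
import Mathlib.NumberTheory.NumberField.Completion.FinitePlace
import Mathlib.Analysis.Complex.Polynomial.Basic
import Mathlib.Analysis.Real.Sqrt
import Mathlib.LinearAlgebra.QuadraticForm.Basic
import Literature.NumberTheory.QuadraticForms.HilbertSymbolLocalQuinary
import Literature.NumberTheory.QuadraticForms.HasseMinkowski
import HarnessLib

/-!
# Isotropy and isometry of diagonal quadratic forms; local isotropy at the places of a number field

Topic `NumberTheory/QuadraticForms`; namespace `Literature.NumberTheory.QuadraticForms`. Everything here is
proved. This is the vocabulary file of the Hasse–Minkowski theorem over NUMBER FIELDS (O'Meara, *Introduction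
to Quadratic Forms*, §66: Thm 66:1 isotropy, Thm 66:4 isometry), proved in the sibling files
`DiagonalFormIsotropyAlgebra`, `HasseMinkowskiNumberFieldLow`, `HasseMinkowskiNumberFieldStep`,
`HasseMinkowskiNumberField` (66:1) and `DiagonalFormWittCancellation`, `HasseMinkowskiIsometryNumberField`
(66:4); the rational case (Serre's Thm 8) is `hasseMinkowski_holds` (`MeyerProofs.lean`).

* `DiagIsotropic c` — the diagonal form `⟨c₁,…,cₙ⟩ = ∑ cᵢ xᵢ²` over a commutative ring has a non-trivial
  zero (O'Meara §42D "isotropic", p. 94). Bridges: `diagIsotropic_iff_not_anisotropic` (Mathlib's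
  `QuadraticMap.weightedSumSquares F c` is not `Anisotropic`) and `representsZero_diagonal_iff` (this
  directory's `RepresentsZero (Matrix.diagonal c)`, Serre IV §1.6).
* `DiagIsometric a b` — `⟨a₁,…,aₙ⟩ ≅ ⟨b₁,…,bₙ⟩`: `ᵗg · diag(a) · g = diag(b)` for some `g ∈ GLₙ` (O'Meara §41B).
* API: transport along injective ring maps / ring isomorphisms, extension by zero along an injective
  re-indexing (`DiagIsotropic.of_comp_injective`), two-coordinate witnesses, the archimedean cases
  (`real_of_indefinite`, `complex`).
* Number fields: `diagIsotropic_infinitePlace` — a diagonal form in `n ≥ 2` variables which is indefinite at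
  every real embedding is isotropic in every archimedean completion (O'Meara §61A–B); and
  `diagIsotropic_adicCompletion_of_five_le` — **O'Meara 63:19** ("A quadratic space `V` over a local field
  is isotropic if `dim V ≥ 5`") for the completions `F_v` at the finite places, from
  `exists_quinary_zero` (`HilbertSymbolLocalQuinary.lean`, Serre IV §2.2 Thm 6 (iv)).

Every quadratic space over a field of characteristic `≠ 2` has an orthogonal basis (O'Meara 42:1), so the
diagonal vocabulary loses no generality over fields. -- TODO(general form): restate 66:1/66:4 for
`QuadraticForm F V` via `QuadraticForm.equivalent_weightedSumSquares`.

Provenance: this cluster was first written inside the `pub-hodgecm` formalisation cell (package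
`HodgeCMPerL`, files `HodgeCM/Literature/{HasseMinkowski,OMeara6319Holds,OMeara661*,OMeara664*}.lean`, gate runs
18–29, axioms `[propext, Classical.choice, Quot.sound]`) over a vendored copy of this directory, and is
upstreamed here unchanged in mathematics.

## References

* O. T. O'Meara, *Introduction to Quadratic Forms*, Grundlehren 117, Springer 1963: §41B (change of base),
  §42A/42:1 (orthogonal bases, p. 88), §42D (isotropy, p. 94), §61A–B (real and complex complete fields,
  pp. 154–155), §63C Prop. 63:19 (p. 170), §66 (pp. 186–189). [Omeara1963]
* J.-P. Serre, *A Course in Arithmetic*, GTM 7, Ch. IV §1.6, §2.2 Thm 6 (iv). [Serre1973]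
-/

noncomputable section

open NumberField IsDedekindDomain
open scoped Matrix NumberField

namespace Literature.NumberTheory.QuadraticForms

/-! ## Vocabulary: isotropy and isometry of diagonal forms over a commutative ring -/

/-- The diagonal quadratic form `⟨c₁, …, cₙ⟩`, `x ↦ ∑ᵢ cᵢ xᵢ²`, over the commutative ring `A` **is
isotropic**: it has a non-trivial zero in `Aⁿ`.  O'Meara §42D: "Let `x` be a non-zero vector in the
quadratic space `V`: we call `x` isotropic if `Q(x) = 0` … we call `V` isotropic if it contains an
isotropic vector"; a space with orthogonal base `x₁,…,xₙ`, `Q(xᵢ) = cᵢ`, is `⟨c₁⟩ ⊥ ⋯ ⊥ ⟨cₙ⟩` and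
`Q(∑ λᵢxᵢ) = ∑ cᵢλᵢ²` (§42A; every non-zero quadratic space has an orthogonal base, 42:1 p. 88).
[cite: Omeara1963, §42D p. 94] -/
def DiagIsotropic {A : Type*} [CommRing A] {n : ℕ} (c : Fin n → A) : Prop :=
  ∃ x : Fin n → A, x ≠ 0 ∧ ∑ i, c i * x i ^ 2 = 0

/-- The diagonal quadratic spaces `⟨a₁,…,aₙ⟩` and `⟨b₁,…,bₙ⟩` over `A` **are isometric**: some
`g ∈ GLₙ(A)` has `ᵗg · diag(a) · g = diag(b)` (change of base of a quadratic space, O'Meara §41B: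
the matrices of one space in two bases are related by `ᵗT M T`, `T` invertible; isometric spaces §41A).
[cite: Omeara1963, §41B] -/
def DiagIsometric {A : Type*} [CommRing A] {n : ℕ} (a b : Fin n → A) : Prop :=
  ∃ g : GL (Fin n) A, (g : Matrix (Fin n) (Fin n) A).transpose * Matrix.diagonal a *
    (g : Matrix (Fin n) (Fin n) A) = Matrix.diagonal b

/-- Unfolding of `DiagIsotropic`. [folklore] -/
theorem diagIsotropic_iff {A : Type*} [CommRing A] {n : ℕ} (c : Fin n → A) :
    DiagIsotropic c ↔ ∃ x : Fin n → A, x ≠ 0 ∧ ∑ i, c i * x i ^ 2 = 0 := Iff.rfl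

/-- Unfolding of `DiagIsometric`. [folklore] -/
theorem diagIsometric_iff {A : Type*} [CommRing A] {n : ℕ} (a b : Fin n → A) :
    DiagIsometric a b ↔ ∃ g : GL (Fin n) A, (g : Matrix (Fin n) (Fin n) A).transpose *
      Matrix.diagonal a * (g : Matrix (Fin n) (Fin n) A) = Matrix.diagonal b := Iff.rfl

/-- Bridge to Mathlib: `⟨c⟩` is isotropic iff the quadratic form `QuadraticMap.weightedSumSquares A c`
(`x ↦ ∑ cᵢ • (xᵢ * xᵢ)`) is not anisotropic. [folklore] -/
theorem diagIsotropic_iff_not_anisotropic {A : Type*} [CommRing A] {n : ℕ} (c : Fin n → A) :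
    DiagIsotropic c ↔ ¬ (QuadraticMap.weightedSumSquares A c).Anisotropic := by
  rw [QuadraticMap.not_anisotropic_iff_exists]
  simp only [DiagIsotropic, QuadraticMap.weightedSumSquares_apply, smul_eq_mul, sq]

/-- Bridge to `RepresentsZero` (`HasseMinkowski.lean`, Serre IV §1.6): the form of the diagonal matrix
`diag(c)` represents zero iff `⟨c⟩` is isotropic. [folklore] -/
theorem representsZero_diagonal_iff {A : Type*} [CommRing A] {n : ℕ} (c : Fin n → A) :
    RepresentsZero (Matrix.diagonal c) ↔ DiagIsotropic c := by
  have key : ∀ x : Fin n → A, Matrix.toBilin' (Matrix.diagonal c) x x = ∑ i, c i * x i ^ 2 := by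
    intro x
    rw [Matrix.toBilin'_apply']
    simp only [dotProduct, Matrix.mulVec_diagonal]
    exact Finset.sum_congr rfl fun i _ => by ring
  simp only [RepresentsZero, DiagIsotropic, key]

namespace DiagIsotropic

variable {A B : Type*} [CommRing A] [CommRing B] {n m : ℕ}

/-- Isotropy is transported along an injective ring homomorphism (in particular from a field to any
extension field: the "only if" half of O'Meara 66:1). [folklore] -/
theorem map {c : Fin n → A} (h : DiagIsotropic c) (f : A →+* B) (hf : Function.Injective f) :
    DiagIsotropic (fun i => f (c i)) := by
  obtain ⟨x, hx0, hx⟩ := h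
  refine ⟨fun i => f (x i), ?_, ?_⟩
  · intro h0
    apply hx0
    funext i
    exact hf (by simpa using congrFun h0 i)
  · have := congrArg f hx
    simpa [map_sum, map_mul, map_pow] using this

/-- Isotropy descends along a ring isomorphism. [folklore] -/
theorem of_ringEquiv (e : A ≃+* B) {c : Fin n → A} (h : DiagIsotropic (fun i => e (c i))) :
    DiagIsotropic c := by
  have h' := h.map e.symm.toRingHom e.symm.injective
  simpa using h'

/-- A diagonal form is isotropic as soon as the sub-form on the image of an injective re-indexing
`e : Fin m → Fin n` is: extend an isotropic vector by zero. [folklore] -/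
theorem of_comp_injective {c : Fin n → A} (e : Fin m → Fin n) (he : Function.Injective e)
    (h : DiagIsotropic (c ∘ e)) : DiagIsotropic c := by
  classical
  obtain ⟨x, hx0, hx⟩ := h
  let y : Fin n → A := Function.extend e x 0
  have hy : ∀ k, y (e k) = x k := fun k => he.extend_apply x 0 k
  have hy' : ∀ j, (∀ k, e k ≠ j) → y j = 0 := by
    intro j hj
    simp only [y]
    rw [Function.extend_apply' _ _ _ (by rintro ⟨k, rfl⟩; exact hj k rfl)]
    rfl
  refine ⟨y, ?_, ?_⟩
  · intro h
    apply hx0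
    funext k
    have := congrFun h (e k)
    rw [hy] at this
    exact this
  · -- the sum over `Fin n` reduces to the sum over the image of `e`
    have hsplit : ∑ j, c j * y j ^ 2 = ∑ j ∈ Finset.univ.image e, c j * y j ^ 2 := by
      symm
      apply Finset.sum_subset (Finset.subset_univ _)
      intro j _ hj
      have : ∀ k, e k ≠ j := by
        intro k hk
        exact hj (Finset.mem_image.2 ⟨k, Finset.mem_univ _, hk⟩)
      rw [hy' j this]
      ring
    rw [hsplit, Finset.sum_image (fun k _ l _ hkl => he hkl)]
    simp only [Function.comp_apply] at hx
    simpa [hy] using hx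

/-- A diagonal form with two entries `cᵢ`, `cⱼ` (`i ≠ j`) admitting `u ≠ 0`, `w` with
`cᵢu² + cⱼw² = 0` is isotropic (the vector with coordinates `u` at `i`, `w` at `j`, `0` elsewhere).
[folklore] -/
theorem of_two {c : Fin n → A} {i j : Fin n} (hij : i ≠ j) (u w : A) (hu : u ≠ 0)
    (h : c i * u ^ 2 + c j * w ^ 2 = 0) : DiagIsotropic c := by
  classical
  refine ⟨fun k => if k = i then u else if k = j then w else 0, ?_, ?_⟩
  · intro hx
    have := congrFun hx i
    simp only [if_true, Pi.zero_apply] at this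
    exact hu this
  · rw [Fintype.sum_eq_add i j hij]
    · simpa [hij.symm] using h
    · intro k hk
      simp [hk.1, hk.2]

/-- Over `ℝ`: an indefinite diagonal form (some `cᵢ < 0`, some `cⱼ > 0`) is isotropic
(O'Meara §61A pp. 154–155: over a real complete field `ind V = min(ind⁺V, ind⁻V)`; the explicit zero has
`√c_j` at `i` and `√(-cᵢ)` at `j`). [cite: Omeara1963, §61A pp. 154–155] -/
theorem real_of_indefinite {c : Fin n → ℝ} {i j : Fin n} (hi : c i < 0) (hj : 0 < c j) :
    DiagIsotropic c := by
  have hij : i ≠ j := by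
    rintro rfl
    exact lt_irrefl _ (hi.trans hj)
  refine of_two hij (Real.sqrt (c j)) (Real.sqrt (-c i)) (Real.sqrt_pos.mpr hj).ne' ?_
  rw [Real.sq_sqrt hj.le, Real.sq_sqrt (neg_nonneg.mpr hi.le)]
  ring

/-- Over `ℂ`: every diagonal form in `n ≥ 2` variables is isotropic (O'Meara §61B: every element of `ℂ`
is a square, so quadratic spaces over `ℂ` are classified by dimension). [cite: Omeara1963, §61B p. 155] -/
theorem complex (hn : 2 ≤ n) (c : Fin n → ℂ) : DiagIsotropic c := by
  set i₀ : Fin n := ⟨0, by omega⟩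
  set i₁ : Fin n := ⟨1, by omega⟩
  have h01 : i₁ ≠ i₀ := by simp [i₀, i₁, Fin.ext_iff]
  by_cases hc : c i₀ = 0
  · exact of_two h01.symm 1 0 one_ne_zero (by simp [hc])
  · obtain ⟨u, hu⟩ := IsAlgClosed.exists_eq_mul_self (-c i₀)
    obtain ⟨w, hw⟩ := IsAlgClosed.exists_eq_mul_self (c i₁)
    have hu0 : u ≠ 0 := by
      rintro rfl
      exact hc (by simpa using hu)
    refine of_two h01 u w hu0 ?_
    rw [sq, sq, ← hu, ← hw]
    ring

/-- If some coefficient vanishes (over a non-trivial ring), the corresponding basis vector is an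
isotropic vector. [folklore] -/
theorem of_eq_zero [Nontrivial A] {c : Fin n → A} {i : Fin n} (hi : c i = 0) : DiagIsotropic c := by
  classical
  refine ⟨Pi.single i 1, ?_, ?_⟩
  · intro h
    have := congrFun h i
    simp at this
  · rw [Finset.sum_eq_single i (fun j _ hji => by simp [hji]) (by simp)]
    simp [hi]

end DiagIsotropic

namespace DiagIsometric

variable {A B : Type*} [CommRing A] [CommRing B] {n : ℕ}

/-- Isometry classes are transported along ring homomorphisms (base change of the isometry; the "only
if" half of O'Meara 66:4). [folklore] -/
theorem map {a b : Fin n → A} (h : DiagIsometric a b) (f : A →+* B) :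
    DiagIsometric (fun i => f (a i)) (fun i => f (b i)) := by
  obtain ⟨g, hg⟩ := h
  refine ⟨Matrix.GeneralLinearGroup.map f g, ?_⟩
  have hd : ∀ d : Fin n → A, Matrix.diagonal (fun i => f (d i)) = (Matrix.diagonal d).map f := fun d => by
    rw [Matrix.diagonal_map (map_zero f)]
  have hcoe : ((Matrix.GeneralLinearGroup.map f g : GL (Fin n) B) : Matrix (Fin n) (Fin n) B) =
      (g : Matrix (Fin n) (Fin n) A).map f := rfl
  rw [hcoe, hd, hd, ← Matrix.transpose_map, ← Matrix.map_mul, ← Matrix.map_mul, hg]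

end DiagIsometric

/-! ## The archimedean places of a number field -/

/-- Local solubility at an archimedean place of a diagonal form in `n ≥ 2` variables which is indefinite
at every real embedding: real places via `v.Completion ≃+* ℝ` and `DiagIsotropic.real_of_indefinite`
(O'Meara §61A), complex places via `v.Completion ≃+* ℂ` and `DiagIsotropic.complex` (§61B).
[cite: Omeara1963, §61A–B pp. 154–155] -/
theorem diagIsotropic_infinitePlace (F : Type*) [Field F] [NumberField F] {n : ℕ} (hn : 2 ≤ n)
    (c : Fin n → F) (hind : ∀ ρ : F →+* ℝ, ∃ i j, ρ (c i) < 0 ∧ 0 < ρ (c j)) (v : InfinitePlace F) :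
    DiagIsotropic (fun i => algebraMap F v.Completion (c i)) := by
  rcases v.isReal_or_isComplex with hv | hv
  · let e := InfinitePlace.Completion.ringEquivRealOfIsReal hv
    obtain ⟨i, j, hi, hj⟩ := hind (e.toRingHom.comp (algebraMap F v.Completion))
    exact DiagIsotropic.of_ringEquiv e (DiagIsotropic.real_of_indefinite (i := i) (j := j) hi hj)
  · let e := InfinitePlace.Completion.ringEquivComplexOfIsComplex hv
    exact DiagIsotropic.of_ringEquiv e (DiagIsotropic.complex hn _)

/-- The "only if" half of O'Meara 66:1: a global isotropic vector is isotropic in every completion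
(archimedean and non-archimedean). [cite: Omeara1963, §66 Thm 66:1 (trivial direction)] -/
theorem DiagIsotropic.forall_place (F : Type*) [Field F] [NumberField F] {n : ℕ} (c : Fin n → F)
    (h : DiagIsotropic c) :
    (∀ v : InfinitePlace F, DiagIsotropic (fun i => algebraMap F v.Completion (c i))) ∧
    (∀ v : HeightOneSpectrum (𝓞 F), DiagIsotropic (fun i => algebraMap F (v.adicCompletion F) (c i))) :=
  ⟨fun v => h.map _ (algebraMap F v.Completion).injective,
   fun v => h.map _ (algebraMap F (v.adicCompletion F)).injective⟩

/-! ## The finite places: O'Meara 63:19 -/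

/-- **O'Meara 63:19** (§63C p. 170): "A quadratic space `V` over a local field is isotropic if
`dim V ≥ 5`" — for the completions `F_v` of a number field `F` at its finite places `v` (these are local
fields, 32:4) and diagonal forms `⟨c₁,…,cₙ⟩`, `n ≥ 5`, `cᵢ` arbitrary: if some `cᵢ = 0` the `i`-th basis
vector is isotropic, otherwise `exists_quinary_zero` (Serre IV §2.2 Thm 6 (iv), proved in
`HilbertSymbolLocalQuinary.lean` from `(F_vˣ : F_vˣ²) ≥ 4`) gives a zero supported on the first five
coordinates. [cite: Omeara1963, §63C Prop. 63:19 p. 170] -/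
theorem diagIsotropic_adicCompletion_of_five_le (F : Type) [Field F] [NumberField F]
    (v : HeightOneSpectrum (𝓞 F)) {n : ℕ} (hn : 5 ≤ n) (c : Fin n → v.adicCompletion F) :
    DiagIsotropic c := by
  classical
  by_cases h0 : ∃ i, c i = 0
  · obtain ⟨i, hi⟩ := h0
    exact DiagIsotropic.of_eq_zero hi
  · simp only [not_exists] at h0
    let e : Fin 5 → Fin n := Fin.castLE hn
    refine DiagIsotropic.of_comp_injective e (Fin.castLE_injective hn) ?_
    obtain ⟨x, hx0, hx⟩ := exists_quinary_zero F v (h0 (e 0)) (h0 (e 1)) (h0 (e 2)) (h0 (e 3)) (h0 (e 4))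
    refine ⟨x, hx0, ?_⟩
    simpa [Fin.sum_univ_five] using hx

end Literature.NumberTheory.QuadraticForms

end
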